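import Summits.QuantumFields.YangMills.Theorems.LangevinControlUVFemtoCurvatureTwoPointCOddChessboardHelpers
import HarnessLib

/-!
# Route `LangevinControlUV`, crux `FemtoCurvatureTwoPointC` (stmt-QuantumFields-16204): a PARTIAL
# chessboard estimate for the `01`-plaquette field on ODD tori (file 2 of 2)

The full chessboard estimate is FALSE on odd tori for general compact `G`
(`FemtoCurvatureTwoPoint.Negative.ChessboardOddTorus`), and the even machinery (p114602) needs even
sides. Substitute proved here (line `conditional-covariance-floor`, stub V′, odd tori), for every
bounded measurable `f ≥ 0`, compact `G`, continuous `ρ`, `β ≥ 0`, odd `L ≥ 3`: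
`(E f(P_0))^{n⁴} ≤ E ∏_{x ∈ B} f(P_x)` for a box `B` of `n⁴` sites with `L < 2n`
(`odd_partialChessboard`, registered form `stub_oddPartialChessboard`). Ingredients: admissibility
of plaquette functions for the transported MIXED odd reflection (`dependsOn_plaq01_odd`), the box
doubling step `ψ(S)² ≤ ψ(S ∪ θS)` from reflection Cauchy–Schwarz against `1` (`box_step`), and run
doubling `1 → 2 → ⋯ → 2^J` per direction (`direction_iterate`; transverse runs mirrored across the
link hyperplane, in-plane runs of plaquette columns mirrored across the fixed site hyperplane). The
homogeneous configuration is never reached (parity), but `n = 2^J > L/2` cells per direction are.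
References: Fröhlich–Israel–Lieb–Simon, CMP 62 (1978) Thm. 2.1–2.2; Osterwalder–Seiler 1978 §2;
Seiler LNP 159 Ch. 2. All statements here are proved. [folklore]
-/

noncomputable section

open scoped BigOperators
open MeasureTheory
open Literature.MathematicalPhysics.QuantumFieldTheory

namespace Summit.QuantumFields.YangMills.Theorems.FemtoCurvatureTwoPointC.OddChessboard

open Summit.QuantumFields.YangMills.Theorems.FemtoCurvatureTwoPoint.PlaquetteProductRPCS
open Summit.QuantumFields.YangMills.Theorems.FiniteSusceptibilityWeakCoupling (RPCauchySchwarz.theta_theta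
  RPCauchySchwarz.measurable_theta RPCauchySchwarz.map_theta RPCauchySchwarz.dependsOn_add_mul)

section Lattice

variable {L N : ℕ} [NeZero L] {G : Type*} [Group G] [TopologicalSpace G]
  [IsTopologicalGroup G] [CompactSpace G] [MeasurableSpace G] [BorelSpace G]
  (ρ : G →* Matrix (Fin N) (Fin N) ℂ)

omit [TopologicalSpace G] [IsTopologicalGroup G] [CompactSpace G] [MeasurableSpace G]
  [BorelSpace G] in
/-- **Admissibility**: if `1 ≤ (xᵢ − (k−1)).val ≤ L/2` (`L` odd), every function of the
`01`-plaquette holonomy at `x` depends only on links whose pull-back by `Φ = τ_{(k−1)eᵢ} ∘ (0 i)_*`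
is odd-positive or shared — in all four directions `i` (transverse: the four links sit in the slice
`xᵢ`; in-plane: the far spatial link sits at `xᵢ + 1 ≤ L/2 + 1`, the shared hyperplane). [folklore] -/
theorem dependsOn_plaq01_odd (hL : Odd L) (i : Fin 4) (k : ZMod L) {x : Site 4 L}
    (hx1 : 1 ≤ (x i - (k - 1)).val) (hx2 : (x i - (k - 1)).val ≤ L / 2) (φ : G → ℝ) :
    DependsOn (fun U : GaugeConfig 4 L G => φ (plaquetteHolonomy U x 0 1))
      {e : Edge 4 L |
        WilsonOddRP.IsOPosEdge ((sitePerm (Equiv.swap 0 i).symm (e.1 - Pi.single i (k - 1)),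
          (Equiv.swap 0 i).symm e.2) : Edge 4 L) ∨
        WilsonOddRP.IsOSharedEdge ((sitePerm (Equiv.swap 0 i).symm (e.1 - Pi.single i (k - 1)),
          (Equiv.swap 0 i).symm e.2) : Edge 4 L)} := by
  obtain ⟨m, hm⟩ := hL -- adapted from `PlaquetteProductRPCS.dependsOn_plaq01_site`
  haveI : Fact (1 < L) := ⟨by omega⟩
  have hval : (x i + 1 - (k - 1)).val = (x i - (k - 1)).val + 1 := by
    rw [show x i + 1 - (k - 1) = (x i - (k - 1)) + 1 by ring, ZMod.val_add, ZMod.val_one,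
      Nat.mod_eq_of_lt]
    omega
  have hedge : ∀ (y : Site 4 L) (a : Fin 4), (y i = x i ∨ (y i = x i + 1 ∧ a ≠ i)) →
      WilsonOddRP.IsOPosEdge ((sitePerm (Equiv.swap 0 i).symm (y - Pi.single i (k - 1)),
          (Equiv.swap 0 i).symm a) : Edge 4 L) ∨
        WilsonOddRP.IsOSharedEdge ((sitePerm (Equiv.swap 0 i).symm (y - Pi.single i (k - 1)),
          (Equiv.swap 0 i).symm a) : Edge 4 L) := by
    intro y a h
    have ht : (sitePerm (Equiv.swap (0 : Fin 4) i).symm (y - Pi.single i (k - 1))) 0 =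
        y i - (k - 1) := by
      simp [sitePerm_apply]
    rcases h with h | ⟨h, hai⟩
    · left; simp only [WilsonOddRP.IsOPosEdge, ht, h]; exact ⟨hx1, hx2⟩
    · have ha0 : (Equiv.swap (0 : Fin 4) i).symm a ≠ 0 := by
        rw [Equiv.symm_swap, Ne, swap_zero_apply_eq_zero_iff]; exact hai
      rcases lt_or_eq_of_le hx2 with hlt | heq
      · left; simp only [WilsonOddRP.IsOPosEdge, ht, h, hval]; omega
      · right; simp only [WilsonOddRP.IsOSharedEdge, ht, h, hval]; exact ⟨ha0, by omega⟩
  have h10 : (1 : Fin 4) ≠ 0 := by decide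
  have hs0 : (x.shift 0) i = x i ∨ ((x.shift 0) i = x i + 1 ∧ (1 : Fin 4) ≠ i) := by
    by_cases hi : i = 0
    · subst hi; exact Or.inr ⟨WilsonRP.shift_apply_self x 0, h10⟩
    · exact Or.inl (WilsonRP.shift_apply_of_ne x hi)
  have hs1 : (x.shift 1) i = x i ∨ ((x.shift 1) i = x i + 1 ∧ (0 : Fin 4) ≠ i) := by
    by_cases hi : i = 1
    · subst hi; exact Or.inr ⟨WilsonRP.shift_apply_self x 1, h10.symm⟩
    · exact Or.inl (WilsonRP.shift_apply_of_ne x hi)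
  intro U V hUV
  simp only [plaquetteHolonomy]
  rw [hUV (x, 0) (hedge x 0 (Or.inl rfl)), hUV (x.shift 0, 1) (hedge _ 1 hs0),
    hUV (x.shift 1, 0) (hedge _ 0 hs1), hUV (x, 1) (hedge x 1 (Or.inl rfl))]

/-- **The box doubling step on the odd torus** (`L` odd, `L ≥ 3`, continuous `ρ`, `β ≥ 0`,
bounded measurable `f`): for a box `∏_a I_a` whose `i`-th factor is admissible for the reflection
with parameter `k` and disjoint from its image under the induced coordinate map `t`,
`ψ(∏ I)² ≤ ψ(∏ I[i ↦ I_i ∪ t I_i])`, `ψ(S) = ∫ ∏_{x∈S} f(N − Re tr ρ(U_{x;01})) dμ_β`. [folklore] -/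
theorem box_step (hL : Odd L) (hL3 : 3 ≤ L) (hρ : Continuous ρ) {β : ℝ} (hβ : 0 ≤ β)
    {f : ℝ → ℝ} (hfm : Measurable f) {M : ℝ} (hfb : ∀ t, |f t| ≤ M) (i : Fin 4) (k : ZMod L)
    (t : ZMod L → ZMod L)
    (ht : t = if i = 0 ∨ i = 1 then (fun c => 2 * k - 2 - c) else fun c => 2 * k - 1 - c)
    (I : Fin 4 → Finset (ZMod L))
    (hadm : ∀ c ∈ I i, 1 ≤ (c - (k - 1)).val ∧ (c - (k - 1)).val ≤ L / 2)
    (hdisj : Disjoint (I i) ((I i).image t)) :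
    (∫ U, ∏ x ∈ Fintype.piFinset I, f ((N : ℝ) - (ρ (plaquetteHolonomy U x 0 1)).trace.re)
        ∂(wilsonMeasure (d := 4) (L := L) ρ β)) ^ 2 ≤
      ∫ U, ∏ x ∈ Fintype.piFinset (Function.update I i (I i ∪ (I i).image t)),
          f ((N : ℝ) - (ρ (plaquetteHolonomy U x 0 1)).trace.re)
        ∂(wilsonMeasure (d := 4) (L := L) ρ β) := by
  haveI := isProbabilityMeasure_wilsonMeasure (d := 4) (L := L) ρ hρ β
  set π : Equiv.Perm (Fin 4) := Equiv.swap 0 i with hπ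
  set v : Site 4 L := Pi.single i (k - 1) with hv
  set E : Set (Edge 4 L) := {e : Edge 4 L |
      WilsonOddRP.IsOPosEdge ((sitePerm π.symm (e.1 - v), π.symm e.2) : Edge 4 L) ∨
        WilsonOddRP.IsOSharedEdge ((sitePerm π.symm (e.1 - v), π.symm e.2) : Edge 4 L)} with hE
  set g : GaugeConfig 4 L G → Site 4 L → ℝ :=
    fun U x => f ((N : ℝ) - (ρ (plaquetteHolonomy U x 0 1)).trace.re) with hg
  -- the induced map on sites and its injectivity
  have htt : ∀ c, t (t c) = c := fun c => by
    rw [ht]; split_ifs <;> simp only <;> ring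
  set θ : Site 4 L → Site 4 L := fun x => Function.update x i (t (x i)) with hθ
  have hθinj : Function.Injective θ := by
    intro x y hxy
    have hi : t (x i) = t (y i) := by simpa [hθ] using congrFun hxy i
    funext j
    by_cases hj : j = i
    · subst hj; simpa [htt] using congrArg t hi
    · simpa [hθ, Function.update_of_ne hj] using congrFun hxy j
  have hgm : ∀ x, Measurable fun U => g U x := fun x =>
    hfm.comp (measurable_const.sub (measurable_re_tr_plaq01 ρ hρ x))
  have hgb : ∀ U x, |g U x| ≤ M := fun U x => hfb _
  have hgΘ : ∀ U x, g (torusConfigShift v (configPerm π (GaugeConfig.timeReflect (configPerm π.symm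
      (torusConfigShift (-v) U))))) x = g U (θ x) := fun U x => by
    by_cases h01 : i = 0 ∨ i = 1
    · simp only [hg, hπ, hv, hθ, ht, h01, if_true, re_tr_plaq01_oddTheta_inplane ρ hρ h01]
    · have hi0 : i ≠ 0 := fun h => h01 (Or.inl h)
      have hi1 : i ≠ 1 := fun h => h01 (Or.inr h)
      simp only [hg, hπ, hv, hθ, ht, h01, if_false, plaq01_oddTheta_transverse hi0 hi1]
  have hD : ∀ (H K : GaugeConfig 4 L G → ℝ) (s : ℝ), DependsOn H E → DependsOn K E →
      DependsOn (fun U => H U + s * K U) E :=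
    fun H K s hH hK => RPCauchySchwarz.dependsOn_add_mul hH hK s
  have hD1 : DependsOn (fun _ : GaugeConfig 4 L G => (1 : ℝ)) E := fun _ _ _ => rfl
  have hRP : ∀ H : GaugeConfig 4 L G → ℝ, Measurable H → (∃ C : ℝ, ∀ U, |H U| ≤ C) →
      DependsOn H E → 0 ≤ ∫ U, H (torusConfigShift v (configPerm π (GaugeConfig.timeReflect
        (configPerm π.symm (torusConfigShift (-v) U))))) * H U
          ∂(wilsonMeasure (d := 4) (L := L) ρ β) :=
    fun H hH hHb hHD => integral_oddTheta_mul_nonneg ρ hL hL3 hρ hβ π v H hH hHb hHD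
  have hSD : DependsOn (fun U => ∏ x ∈ Fintype.piFinset I, g U x) E :=
    dependsOn_finset_prod fun x hx => by
      obtain ⟨h1, h2⟩ := hadm (x i) (Fintype.mem_piFinset.1 hx i)
      exact dependsOn_plaq01_odd ⟨L / 2, by obtain ⟨m, hm⟩ := hL; omega⟩ i k h1 h2
        fun a => f ((N : ℝ) - (ρ a).trace.re)
  have hdisj' : Disjoint (Fintype.piFinset I) ((Fintype.piFinset I).image θ) := by
    rw [image_update_piFinset]
    refine Fintype.piFinset_disjoint_of_disjoint _ _ (a := i) ?_
    simpa only [Function.update_self] using hdisj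
  have key := sq_integral_prod_le (μ := wilsonMeasure (d := 4) (L := L) ρ β)
    (RPCauchySchwarz.measurable_theta π v) (RPCauchySchwarz.map_theta ρ hρ β π v)
    (RPCauchySchwarz.theta_theta π v) hRP hD hD1 hθinj g hgm hgb hgΘ (Fintype.piFinset I) hSD hdisj'
  rw [image_update_piFinset] at key
  have hI : Fintype.piFinset I = Fintype.piFinset (Function.update I i (I i)) := by
    rw [Function.update_eq_self]
  rw [hI, piFinset_update_union] at key
  rw [hI]
  exact key

end Lattice

/-! ## The partial chessboard estimate on odd tori -/

section Main

variable {L N : ℕ} [NeZero L] {G : Type*} [Group G] [TopologicalSpace G]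
  [IsTopologicalGroup G] [CompactSpace G] [MeasurableSpace G] [BorelSpace G]
  (ρ : G →* Matrix (Fin N) (Fin N) ℂ)

/-- **One direction**: `J` doublings of the `i`-th factor (`2^J ≤ 2m`, `L = 2m+1`), runs
`R_q = {c | (σc).val < q}` (`σ = id` in-plane, `σ = −` transverse):
`ψ(∏ I[i ↦ R_1])^{2^J} ≤ ψ(∏ I[i ↦ R_{2^J}])` and `#R_{2^J} = 2^J`. [folklore] -/
theorem direction_iterate {m : ℕ} (hL : L = 2 * m + 1) (hm : 1 ≤ m) (hρ : Continuous ρ) {β : ℝ}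
    (hβ : 0 ≤ β) {f : ℝ → ℝ} (hfm : Measurable f) (hf0 : ∀ t, 0 ≤ f t) {M : ℝ}
    (hfb : ∀ t, |f t| ≤ M) (i : Fin 4) (σ : ZMod L → ZMod L)
    (hσ : σ = if i = 0 ∨ i = 1 then id else fun c => -c) (I : Fin 4 → Finset (ZMod L)) :
    ∀ J : ℕ, 2 ^ J ≤ 2 * m →
      (∫ U, ∏ x ∈ Fintype.piFinset (Function.update I i
          (Finset.univ.filter fun c : ZMod L => (σ c).val < 1)),
          f ((N : ℝ) - (ρ (plaquetteHolonomy U x 0 1)).trace.re)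
            ∂(wilsonMeasure (d := 4) (L := L) ρ β)) ^ (2 ^ J) ≤
        ∫ U, ∏ x ∈ Fintype.piFinset (Function.update I i
          (Finset.univ.filter fun c : ZMod L => (σ c).val < 2 ^ J)),
          f ((N : ℝ) - (ρ (plaquetteHolonomy U x 0 1)).trace.re)
            ∂(wilsonMeasure (d := 4) (L := L) ρ β) ∧
      (Finset.univ.filter fun c : ZMod L => (σ c).val < 2 ^ J).card = 2 ^ J := by
  have hLodd : Odd L := ⟨m, hL⟩
  have hL3 : 3 ≤ L := by omega
  have hσinj : Function.Injective σ := by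
    rw [hσ]; split_ifs; exacts [fun a b h => h, neg_injective]
  have hσ0 : ∀ c, σ c = 0 ↔ c = 0 := fun c => by
    rw [hσ]; split_ifs; exacts [Iff.rfl, neg_eq_zero]
  -- the runs and the doubling data at level `q`
  set R : ℕ → Finset (ZMod L) := fun q => Finset.univ.filter fun c : ZMod L => (σ c).val < q
    with hR
  set a : ℕ → ℝ := fun j => ∫ U, ∏ x ∈ Fintype.piFinset (Function.update I i (R (2 ^ j))),
      f ((N : ℝ) - (ρ (plaquetteHolonomy U x 0 1)).trace.re)
        ∂(wilsonMeasure (d := 4) (L := L) ρ β) with ha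
  have ha0 : ∀ j, 0 ≤ a j := fun j =>
    integral_nonneg fun U => Finset.prod_nonneg fun x _ => hf0 _
  -- one doubling `q ↦ 2q` for `q ≤ m`
  have hstep : ∀ q : ℕ, 1 ≤ q → q ≤ m →
      (∫ U, ∏ x ∈ Fintype.piFinset (Function.update I i (R q)),
          f ((N : ℝ) - (ρ (plaquetteHolonomy U x 0 1)).trace.re)
            ∂(wilsonMeasure (d := 4) (L := L) ρ β)) ^ 2 ≤
        ∫ U, ∏ x ∈ Fintype.piFinset (Function.update I i (R (2 * q))),
          f ((N : ℝ) - (ρ (plaquetteHolonomy U x 0 1)).trace.re)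
            ∂(wilsonMeasure (d := 4) (L := L) ρ β) ∧
      (R (2 * q)).card = 2 * (R q).card := by
    intro q hq hqm
    -- the reflection parameter `k` and the induced coordinate map `t`
    set k : ZMod L := if i = 0 ∨ i = 1 then ((q : ℕ) : ZMod L) - ((m : ℕ) : ZMod L)
      else 1 - ((q : ℕ) : ZMod L) with hk
    set t : ZMod L → ZMod L := if i = 0 ∨ i = 1 then (fun c => 2 * k - 2 - c)
      else fun c => 2 * k - 1 - c with ht
    have hLz : ((L : ℕ) : ZMod L) = 0 := ZMod.natCast_self L
    have hav1 : (((2 * q - 1 : ℕ) : ZMod L)).val = 2 * q - 1 := ZMod.val_cast_of_lt (by omega)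
    have hav2 : ∀ c, σ (t c) = ((2 * q - 1 : ℕ) : ZMod L) - σ c := by
      rw [hσ, ht, hk]
      have hc1 : ((2 * q - 1 : ℕ) : ZMod L) = 2 * ((q : ℕ) : ZMod L) - 1 := by
        rw [Nat.cast_sub (by omega)]; push_cast; ring
      have hc2 : (2 : ZMod L) * ((m : ℕ) : ZMod L) = -1 := by
        have : (((2 * m + 1 : ℕ)) : ZMod L) = 0 := by rw [← hL]; exact hLz
        push_cast at this; linear_combination this
      intro c
      split_ifs with h01
      · simp only [id_eq, hc1]; linear_combination (-1 : ZMod L) * hc2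
      · simp only [hc1]; ring
    obtain ⟨hunion, hdisj, hcard⟩ :=
      run_double σ t hσinj (((2 * q - 1 : ℕ) : ZMod L)) hq hav1 hav2
    change R q ∪ (R q).image t = R (2 * q) at hunion
    change Disjoint (R q) ((R q).image t) at hdisj
    change (R (2 * q)).card = 2 * (R q).card at hcard
    have hadm : ∀ c ∈ R q, 1 ≤ (c - (k - 1)).val ∧ (c - (k - 1)).val ≤ L / 2 := by
      intro c hc
      simp only [hR, Finset.mem_filter, Finset.mem_univ, true_and, hσ] at hc
      rw [hk]
      split_ifs at hc ⊢ with h01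
      · exact adm_inplane hL hqm hc
      · exact adm_transverse hL hqm hc
    refine ⟨?_, hcard⟩
    have key := box_step ρ hLodd hL3 hρ hβ hfm hfb i k t ht (Function.update I i (R q))
      (by simpa only [Function.update_self] using hadm)
      (by simpa only [Function.update_self] using hdisj)
    rw [Function.update_self, Function.update_idem, hunion] at key
    exact key
  -- the exponent bookkeeping `2^j ≤ m` for `j < J`, `2^J ≤ 2m`
  have hexp : ∀ J j : ℕ, 2 ^ J ≤ 2 * m → j < J → 2 ^ j ≤ m := by
    intro J j hJ hj
    have h1 : 2 ^ (j + 1) ≤ 2 ^ J := Nat.pow_le_pow_right (by norm_num) hj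
    rw [pow_succ] at h1
    omega
  -- iterate the squarings
  intro J hJ
  have hmain : a 0 ^ (2 ^ J) ≤ a J :=
    pow_two_pow_le_of_sq_le ha0 J fun j hj => by
      have h := (hstep (2 ^ j) Nat.one_le_two_pow (hexp J j hJ hj)).1
      rw [← pow_succ'] at h
      exact h
  have hcardJ : ∀ J' : ℕ, 2 ^ J' ≤ 2 * m → (R (2 ^ J')).card = 2 ^ J' := by
    intro J'
    induction J' with
    | zero =>
        intro _
        have h1 : R 1 = {0} := run_one σ hσ0
        rw [pow_zero, h1, Finset.card_singleton]
    | succ J' ih =>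
        intro h
        have h2 := (hstep (2 ^ J') Nat.one_le_two_pow
          (hexp (J' + 1) J' h (Nat.lt_succ_self J'))).2
        rw [← pow_succ'] at h2
        rw [h2, ih (by rw [pow_succ] at h; omega), pow_succ']
  have ha0' : a 0 = ∫ U, ∏ x ∈ Fintype.piFinset (Function.update I i (R 1)),
      f ((N : ℝ) - (ρ (plaquetteHolonomy U x 0 1)).trace.re)
        ∂(wilsonMeasure (d := 4) (L := L) ρ β) := by
    simp only [ha, pow_zero]
  rw [ha0'] at hmain
  exact ⟨hmain, hcardJ J hJ⟩

/-- **The partial chessboard estimate on odd tori.** For `L` odd, `L ≥ 3`, every compact group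
`G`, continuous `ρ`, `β ≥ 0` and bounded measurable `f ≥ 0`: there are `n` with `L < 2n` and a box
`B` of `n⁴` sites with `(E f(P_0))^{n⁴} ≤ E ∏_{x∈B} f(P_x)`, `P_x = N − Re tr ρ(U_{x;01})`,
`E = ∫ · dμ_β` (`n = 2^J`, `2^{J−1} ≤ L/2 < 2^J`; `B = R × R × (−R) × (−R)`, `R = {0,…,n−1}`).
Fröhlich–Israel–Lieb–Simon run doubling from the mixed odd reflection positivity. [folklore] -/
theorem odd_partialChessboard (hL : Odd L) (hL3 : 3 ≤ L) (hρ : Continuous ρ) {β : ℝ}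
    (hβ : 0 ≤ β) {f : ℝ → ℝ} (hfm : Measurable f) (hf0 : ∀ t, 0 ≤ f t) {M : ℝ}
    (hfb : ∀ t, |f t| ≤ M) :
    ∃ n : ℕ, L < 2 * n ∧ ∃ B : Finset (Site 4 L), B.card = n ^ 4 ∧
      (∫ U, f ((N : ℝ) - (ρ (plaquetteHolonomy U 0 0 1)).trace.re)
          ∂(wilsonMeasure (d := 4) (L := L) ρ β)) ^ (n ^ 4) ≤
        ∫ U, ∏ x ∈ B, f ((N : ℝ) - (ρ (plaquetteHolonomy U x 0 1)).trace.re)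
          ∂(wilsonMeasure (d := 4) (L := L) ρ β) := by
  obtain ⟨m, hm⟩ := hL
  have hm1 : 1 ≤ m := by omega
  -- `J` with `2^{J-1} ≤ m < 2^J`
  set J : ℕ := Nat.log 2 m + 1 with hJ
  have hJ1 : 2 ^ J ≤ 2 * m := by
    rw [hJ, pow_succ]; have := Nat.pow_log_le_self 2 (by omega : m ≠ 0); omega
  have hJ2 : m < 2 ^ J := Nat.lt_pow_succ_log_self (by norm_num) m
  refine ⟨2 ^ J, by omega, ?_⟩
  -- `ψ(∏ I)^{2^J} ≤ ψ(∏ I[i ↦ R])` whenever `I i = {0}`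
  have key : ∀ (i : Fin 4) (σ : ZMod L → ZMod L),
      (σ = if i = 0 ∨ i = 1 then id else fun c => -c) → ∀ I : Fin 4 → Finset (ZMod L),
      I i = {0} →
      (∫ U, ∏ x ∈ Fintype.piFinset I, f ((N : ℝ) - (ρ (plaquetteHolonomy U x 0 1)).trace.re)
          ∂(wilsonMeasure (d := 4) (L := L) ρ β)) ^ (2 ^ J) ≤
        ∫ U, ∏ x ∈ Fintype.piFinset (Function.update I i
          (Finset.univ.filter fun c : ZMod L => (σ c).val < 2 ^ J)),
          f ((N : ℝ) - (ρ (plaquetteHolonomy U x 0 1)).trace.re)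
            ∂(wilsonMeasure (d := 4) (L := L) ρ β) ∧
      (Finset.univ.filter fun c : ZMod L => (σ c).val < 2 ^ J).card = 2 ^ J := by
    intro i σ hσ I hIi
    obtain ⟨h, hc⟩ := direction_iterate ρ hm hm1 hρ hβ hfm hf0 hfb i σ hσ I J hJ1
    have hσ0 : ∀ c, σ c = 0 ↔ c = 0 := fun c => by
      rw [hσ]; split_ifs; exacts [Iff.rfl, neg_eq_zero]
    rw [run_one σ hσ0, ← hIi, Function.update_eq_self] at h
    exact ⟨h, hc⟩
  have hσp : (id : ZMod L → ZMod L) = if (0 : Fin 4) = 0 ∨ (0 : Fin 4) = 1 then id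
      else fun c => -c := by simp
  have hσp' : (id : ZMod L → ZMod L) = if (1 : Fin 4) = 0 ∨ (1 : Fin 4) = 1 then id
      else fun c => -c := by simp
  have hσm : (fun c : ZMod L => -c) = if (2 : Fin 4) = 0 ∨ (2 : Fin 4) = 1 then id
      else fun c => -c := by simp
  have hσm' : (fun c : ZMod L => -c) = if (3 : Fin 4) = 0 ∨ (3 : Fin 4) = 1 then id
      else fun c => -c := by simp
  -- the four boxes
  set Rp : Finset (ZMod L) := Finset.univ.filter fun c : ZMod L => (id c).val < 2 ^ J with hRp
  set Rm : Finset (ZMod L) := Finset.univ.filter fun c : ZMod L => (-c).val < 2 ^ J with hRm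
  set I₀ : Fin 4 → Finset (ZMod L) := fun _ => {0} with hI₀
  set I₁ : Fin 4 → Finset (ZMod L) := Function.update I₀ 0 Rp with hI₁
  set I₂ : Fin 4 → Finset (ZMod L) := Function.update I₁ 1 Rp with hI₂
  set I₃ : Fin 4 → Finset (ZMod L) := Function.update I₂ 2 Rm with hI₃
  set I₄ : Fin 4 → Finset (ZMod L) := Function.update I₃ 3 Rm with hI₄
  obtain ⟨h1, hcp⟩ := key 0 id hσp I₀ rfl
  obtain ⟨h2, -⟩ := key 1 id hσp' I₁ (by simp [hI₁, hI₀])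
  obtain ⟨h3, hcm⟩ := key 2 (fun c => -c) hσm I₂ (by simp [hI₂, hI₁, hI₀])
  obtain ⟨h4, -⟩ := key 3 (fun c => -c) hσm' I₃ (by simp [hI₃, hI₂, hI₁, hI₀])
  change _ ≤ ∫ U, ∏ x ∈ Fintype.piFinset I₁, _ ∂_ at h1
  change _ ≤ ∫ U, ∏ x ∈ Fintype.piFinset I₂, _ ∂_ at h2
  change _ ≤ ∫ U, ∏ x ∈ Fintype.piFinset I₃, _ ∂_ at h3
  change _ ≤ ∫ U, ∏ x ∈ Fintype.piFinset I₄, _ ∂_ at h4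
  change Rp.card = 2 ^ J at hcp
  change Rm.card = 2 ^ J at hcm
  refine ⟨Fintype.piFinset I₄, ?_, ?_⟩
  · rw [Fintype.card_piFinset, Fin.prod_univ_four]
    simp [hI₄, hI₃, hI₂, hI₁, hcp, hcm]
    ring
  · -- the start: `∏ I₀ = {0}`
    have h0 : (∫ U, ∏ x ∈ Fintype.piFinset I₀, f ((N : ℝ) - (ρ (plaquetteHolonomy U x 0 1)).trace.re)
        ∂(wilsonMeasure (d := 4) (L := L) ρ β)) =
        ∫ U, f ((N : ℝ) - (ρ (plaquetteHolonomy U 0 0 1)).trace.re)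
          ∂(wilsonMeasure (d := 4) (L := L) ρ β) := by
      simp only [hI₀, Fintype.piFinset_singleton, Finset.prod_singleton]
      rfl
    rw [← h0]
    have hnn : ∀ I : Fin 4 → Finset (ZMod L), 0 ≤ ∫ U, ∏ x ∈ Fintype.piFinset I,
        f ((N : ℝ) - (ρ (plaquetteHolonomy U x 0 1)).trace.re)
          ∂(wilsonMeasure (d := 4) (L := L) ρ β) := fun I =>
      integral_nonneg fun U => Finset.prod_nonneg fun x _ => hf0 _
    -- pure real bookkeeping: `a₀^{n⁴} ≤ a₄` from the four `aⱼ^n ≤ aⱼ₊₁`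
    have chain : ∀ (a0 a1 a2 a3 a4 : ℝ) (n : ℕ), 0 ≤ a0 → 0 ≤ a1 → 0 ≤ a2 → a0 ^ n ≤ a1 →
        a1 ^ n ≤ a2 → a2 ^ n ≤ a3 → a3 ^ n ≤ a4 → a0 ^ (n ^ 4) ≤ a4 := by
      intro a0 a1 a2 a3 a4 n h0 h1' h2' e1 e2 e3 e4
      have hn4 : n ^ 4 = n * n * n * n := by ring
      rw [hn4, pow_mul, pow_mul, pow_mul]
      calc (((a0 ^ n) ^ n) ^ n) ^ n ≤ ((a1 ^ n) ^ n) ^ n :=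
            pow_le_pow_left₀ (by positivity) (pow_le_pow_left₀ (by positivity)
              (pow_le_pow_left₀ (by positivity) e1 n) n) n
        _ ≤ (a2 ^ n) ^ n := pow_le_pow_left₀ (by positivity) (pow_le_pow_left₀ (by positivity) e2 n) n
        _ ≤ a3 ^ n := pow_le_pow_left₀ (by positivity) e3 n
        _ ≤ a4 := e4
    exact chain _ _ _ _ _ (2 ^ J) (hnn I₀) (hnn I₁) (hnn I₂) h1 h2 h3 h4

end Main

end Summit.QuantumFields.YangMills.Theorems.FemtoCurvatureTwoPointC.OddChessboard

namespace Summit.QuantumFields.YangMills.Theorems.FemtoCurvatureTwoPointC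

/-- **Registered sub-goal `stub_oddPartialChessboard`** (`--supports stmt-QuantumFields-16204`, line
`conditional-covariance-floor`, stub V′ odd tori): the partial chessboard estimate on odd tori
`L ≥ 3` for the `01`-plaquette field — `(E f(P_0))^{n⁴} ≤ E ∏_{x∈B} f(P_x)` for a box `B` of
`n⁴` sites with `L < 2n`, every compact `G`, continuous `ρ`, `β ≥ 0`, bounded measurable `f ≥ 0`
(closed form of `OddChessboard.odd_partialChessboard`, fully qualified). [folklore] -/
theorem stub_oddPartialChessboard : ∀ (L N : ℕ) [NeZero L] (G : Type) [Group G] [TopologicalSpace G] [IsTopologicalGroup G] [CompactSpace G] [MeasurableSpace G] [BorelSpace G] (ρ : G →* Matrix (Fin N) (Fin N) ℂ), Odd L → 3 ≤ L → Continuous ρ → ∀ (β : ℝ), 0 ≤ β → ∀ (f : ℝ → ℝ), Measurable f → (∀ t, 0 ≤ f t) → (∃ M : ℝ, ∀ t, |f t| ≤ M) → ∃ n : ℕ, L < 2 * n ∧ ∃ B : Finset (Fin 4 → ZMod L), B.card = n ^ 4 ∧ (∫ U, f ((N : ℝ) - (ρ (Literature.MathematicalPhysics.QuantumFieldTheory.plaquetteHolonomy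 U 0 0 1)).trace.re) ∂(Literature.MathematicalPhysics.QuantumFieldTheory.wilsonMeasure ρ β : MeasureTheory.Measure (Literature.MathematicalPhysics.QuantumFieldTheory.GaugeConfig 4 L G))) ^ (n ^ 4) ≤ ∫ U, ∏ x ∈ B, f ((N : ℝ) - (ρ (Literature.MathematicalPhysics.QuantumFieldTheory.plaquetteHolonomy U x 0 1)).trace.re) ∂(Literature.MathematicalPhysics.QuantumFieldTheory.wilsonMeasure ρ β : MeasureTheory.Measure (Literature.MathematicalPhysics.QuantumFieldTheory.GaugeConfig 4 L G)) := by
  intro L N _ G _ _ _ _ _ _ ρ hL hL3 hρ β hβ f hfm hf0 hfb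
  obtain ⟨M, hM⟩ := hfb
  exact OddChessboard.odd_partialChessboard ρ hL hL3 hρ hβ hfm hf0 hM

end Summit.QuantumFields.YangMills.Theorems.FemtoCurvatureTwoPointC

end
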